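import Mathlib
import Literature.Analysis.FluidPDE.ScalarFourierDefs
import Literature.Analysis.FunctionSpaces.LatticeSymbolAlgebra
import HarnessLib

/-!
# Dictionary: the tree's scalar transport symbol `ScalarFourier.transportSym` is the transport family `∑_j y_j ⋆ ∂_j` of the lattice toolkit (instab g16, cell `ns-blowup`, 2026-08-27)

HONEST FRAMING (human ruling D-0035): nothing here is a claim about Navier–Stokes blow-up.
WHAT THIS IS NOT: not NS evidence — an unconditional re-indexing identity between two spellings of
the Fourier coefficients of `(y·∇)c` that coexist in the tree; no flow, set or certificate.

PURPOSE. The estimates of `TransportCommutatorLattice` / `TransportSkewLattice` /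
`TransportLinearisedLattice` are stated for `T_y c := ∑ j, Lattice.conv (Lattice.scal (y j))
(Lattice.freqDeriv j c)` (Warner-style symbol calculus, `Literature/Analysis/FunctionSpaces/Lattice*`),
while the cell's model files (`AbcLinearisedLattice`, the skew-cut certifier chain, the future
(β2) `Defs` file of `HOME/instab/BETA2-SPEC.md` §2) speak the scalar-Fourier vocabulary
`ScalarFourier.transportSym U c k = ∑_j ∑_m U_j(m) · 2πi (k − m)_j · c(k − m)`
(`Literature/Analysis/FluidPDE/ScalarFourierDefs`). They are the same family:

* `transportSym_eq_sum_conv_scal_freqDeriv` — for scalar coefficient families (`V = ℂ`),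
  `ScalarFourier.transportSym y c k = (∑ j, conv (scal (y j)) (freqDeriv j c)) k` for EVERY `y, c, k`
  (unconditionally: the two `tsum`s are related by the reflection `m ↦ k − m`, which preserves
  summability and the junk value alike).

So every statement of parts I–III applies verbatim to `transportSym` (componentwise for vector
coefficients, as `AbcLinearisedLattice` uses it).
-/

noncomputable section

namespace Summit.NavierStokesRegularity.FluidComputer.TransportSymDictionary

open Finset
open Literature.Analysis.FunctionSpaces Literature.Analysis.FunctionSpaces.Lattice
open Literature.Analysis.FluidPDE Literature.Analysis.FluidPDE.ScalarFourier

variable {d : Type*} [Fintype d]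

omit [Fintype d] in
/-- One component: `(U ⋆_lconv (∂_j c))(k) = (U ⋆ ∂_j c)(k)` — the scalar-Fourier convolution
`lconv U g k = ∑_m U(m) g(k − m)` against the symbol-calculus convolution
`conv (scal U) g k = ∑_l U(k − l) • g(l)`, for `g = ∂_j c`. -/
theorem lconv_dsym_eq_conv_scal_freqDeriv (U c : (d → ℤ) → ℂ) (j : d) (k : d → ℤ) :
    lconv U (fun m => dsym j m * c m) k =
      conv (scal U : (d → ℤ) → (ℂ →L[ℂ] ℂ)) (freqDeriv j c) k := by
  rw [lconv_apply, conv_scal_apply]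
  rw [← tsum_sub_left_eq (fun m => U m * (dsym j (k - m) * c (k - m))) k]
  refine tsum_congr fun l => ?_
  simp only [sub_sub_cancel, freqDeriv_apply, dsym_apply, smul_eq_mul]

/-- **Dictionary**: `ScalarFourier.transportSym y c k = (∑ j, conv (scal (y j)) (freqDeriv j c)) k`
for all scalar coefficient families `y = (y_j)`, `c` and every mode `k`. -/
theorem transportSym_eq_sum_conv_scal_freqDeriv (y : d → (d → ℤ) → ℂ) (c : (d → ℤ) → ℂ)
    (k : d → ℤ) :
    transportSym y c k =
      (∑ j, conv (scal (y j) : (d → ℤ) → (ℂ →L[ℂ] ℂ)) (freqDeriv j c)) k := by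
  rw [transportSym_apply, Finset.sum_apply]
  exact Finset.sum_congr rfl fun j _ => lconv_dsym_eq_conv_scal_freqDeriv (y j) c j k

/-- The same as an identity of families. -/
theorem transportSym_eq_sum_conv_scal_freqDeriv' (y : d → (d → ℤ) → ℂ) (c : (d → ℤ) → ℂ) :
    transportSym y c = ∑ j, conv (scal (y j) : (d → ℤ) → (ℂ →L[ℂ] ℂ)) (freqDeriv j c) :=
  funext fun k => transportSym_eq_sum_conv_scal_freqDeriv y c k

end Summit.NavierStokesRegularity.FluidComputer.TransportSymDictionary

end
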